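import Mathlib
import Summits.NavierStokesRegularity.NavierStokesRegularity.Theorems.EulerZoomLiouvillePowerGaugeEulerLiouvilleCondenserPlaneCore
import Summits.NavierStokesRegularity.NavierStokesRegularity.Theorems.EulerZoomLiouvillePowerGaugeEulerLiouvilleNeedleExitPlanar

/-!
# THE CONDENSER in `ℝ³`: anomalous crossings of the planes `⟪x,e⟫ = s`, `s ∈ [R,2R]`, cost a gradient `exp(c R^{2+ρ})`
(ROUND-42 THEOREM B, static form — nsreg-p2 g33's (B2)–(B4) assembled; only the kinematic first-hit step (B1) is left out)

Width piece for crux `EulerZoomLiouville.PowerGaugeEulerLiouville` (stmt-NavierStokesRegularity-19832), by name under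
LEAD 19832 (ns-typeII-p2 g12); seat ns-ezl-w2 g3, `--supports stmt-NavierStokesRegularity-19832 --as helper`.

* `exists_linearIsometryEquiv_apply_eq` — a linear isometry of `ℝ³` taking a unit vector `e` to `e₂` (a reflection).
* `norm_fderiv_comp_linearIsometryEquiv` — `‖D(V ∘ R⁻¹)(x)‖ = ‖DV(R⁻¹x)‖`.
* `setIntegral_ball_comp_linearIsometryEquiv` — `∫_{B(0,r)} G(R⁻¹x) dx = ∫_{B(0,r)} G`.
* **`exp_le_gradient_or_small_of_crossings` — THEOREM B, STATIC FORM.**  `V ∈ C¹(ℝ³, F)`, `e` a unit vector,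
  ball budgets `∫_{B(0,3R)}‖V‖² ≤ X`, `∫_{B(0,3R)}‖DV‖² ≤ Y`, `‖DV‖ ≤ G_m` on `B(0,3R)`; if EVERY plane `⟪x,e⟫ = s`,
  `s ∈ [R,2R]`, carries an ANOMALOUS point `y₁` (`‖y₁‖ ≤ 2R`, `‖V y₁‖ ≥ γ s`) and there is ROOM
  `8(4X/R)/(π(γR)²) ≤ (3/4)(R/4)²`, then
  `(γR/(4·(R/4)))·exp(π(γR)²/(32·(4Y/R))) ≤ √2·G_m  ∨  π(γR)²/(32·(4Y/R)) ≤ log 2`.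
  [Rotate `e` to `e₂` (static — only `V ∘ R⁻¹`, no flow), pick ezl-w7 g0's quiet plane `exists_quietPlane` (t42-QP) at a
  height `s ∈ [R,2R]`, take the anomalous point on it, apply `exp_le_gradient_or_small_of_plane` (t42-PLANE) with
  `m = γR`, `r★ = R/4`.]

* **`exp_le_gradient_or_small_of_exit` — THEOREM B (nsreg-p2 g33), DYNAMIC FORM**: the kinematic input (B1) — the backward
  orbit of a label exiting `B(0,2R)` from `B(0,R)` crosses every plane `⟪x,e⟫ = s`, `s ∈ [R,2R]` (`e` = the first exit direction),
  at a first-hit point where `γ s ≤ ‖V‖` — is ezl-w7 g0's t42a `exists_firstHit_of_exit` + ns-in-ser-c g3's t42a-PLANAR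
  `exists_anomalous_plane_of_exit`; it discharges `hcross`, so: for a `C¹` field `V` with `‖DV‖ ≤ K` (a cut-off copy), ball
  budgets `X, Y` at radius `3R`, `‖DV‖ ≤ G_m` on `B(0,3R)` and room, ONE backward similarity orbit from `‖y‖ < R` to
  `‖Ψ_L y‖ ≥ 2R` forces `(γR/(4(R/4)))·exp(π(γR)²/(32(4Y/R))) ≤ √2·G_m ∨ π(γR)²/(32(4Y/R)) ≤ log 2`.
* `norm_flow_lt_of_gradient_envelope` — (B′), the contrapositive: a gradient bound below the condenser threshold on `B(0,3R)`
  confines every backward orbit from `B(0,R)` to `‖·‖ < 2R`.  READING (nsreg-p2 g33): with the class gauges `X = C_A(3R)^{1−2ρ}`,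
`Y = C_E(3R)^{1−ρ}` the exponent is `π γ² R² · R/(128·C_E 3^{1−ρ} R^{1−ρ}) = c·γ²R^{2+ρ}/C_E`: LEAVING `B(0,2R)` COSTS A
GRADIENT `exp(c R^{2+ρ})` — the clock exponent `2+ρ` is the E-gauge's condenser exponent.

HONEST FRAMING: real analysis in `ℝ³`; nothing here proves the crux E `PowerGaugeEulerLiouville` (19832 OPEN), any door
Target, or any Navier–Stokes statement; MODEL lattice only (19832 is a crux CLASS — E/NS strata — not NS regularity).
[folklore (length–area method); cite: ConstantinIgnatovaVicol2026Putative, §3.4.1 for the setting]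
-/

noncomputable section

open Set Filter Topology Metric Function MeasureTheory Real
open scoped RealInnerProductSpace

set_option linter.dupNamespace false

namespace Summit.NavierStokesRegularity.NavierStokesRegularity.Theorems.PowerGaugeEulerLiouville.Condenser

/-- A linear isometry of a real inner-product space taking the unit vector `e` to the unit vector `e'` (the reflection in
the bisector hyperplane). [folklore] -/
theorem exists_linearIsometryEquiv_apply_eq {H : Type*} [NormedAddCommGroup H] [InnerProductSpace ℝ H] [CompleteSpace H]
    {e e' : H} (he : ‖e‖ = 1) (he' : ‖e'‖ = 1) : ∃ Rot : H ≃ₗᵢ[ℝ] H, Rot e = e' :=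
  ⟨Submodule.reflection (ℝ ∙ (e - e'))ᗮ, Submodule.reflection_sub (he.trans he'.symm)⟩

/-- Precomposition with a linear isometry does not change the size of the derivative:
`‖D(V ∘ R⁻¹)(x)‖ = ‖DV(R⁻¹ x)‖`. [folklore] -/
theorem norm_fderiv_comp_linearIsometryEquiv {H : Type*} [NormedAddCommGroup H] [InnerProductSpace ℝ H]
    {F : Type*} [NormedAddCommGroup F] [NormedSpace ℝ F] (V : H → F) (Rot : H ≃ₗᵢ[ℝ] H) (x : H) :
    ‖fderiv ℝ (fun z => V (Rot.symm z)) x‖ = ‖fderiv ℝ V (Rot.symm x)‖ := by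
  rw [show (fun z => V (Rot.symm z)) = V ∘ (Rot.symm.toContinuousLinearEquiv : H → H) from rfl,
    ContinuousLinearEquiv.comp_right_fderiv]
  exact ContinuousLinearMap.opNorm_comp_linearIsometryEquiv _ Rot.symm

/-- Ball integrals are invariant under precomposition with a linear isometry. [folklore] -/
theorem setIntegral_ball_comp_linearIsometryEquiv (G : EuclideanSpace ℝ (Fin 3) → ℝ)
    (Rot : EuclideanSpace ℝ (Fin 3) ≃ₗᵢ[ℝ] EuclideanSpace ℝ (Fin 3)) (r : ℝ) :
    ∫ x in ball (0 : EuclideanSpace ℝ (Fin 3)) r, G (Rot.symm x) = ∫ x in ball (0 : EuclideanSpace ℝ (Fin 3)) r, G x := by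
  have h := Rot.symm.measurePreserving.setIntegral_preimage_emb Rot.symm.toHomeomorph.measurableEmbedding G
    (ball (0 : EuclideanSpace ℝ (Fin 3)) r)
  have hpre : (Rot.symm : EuclideanSpace ℝ (Fin 3) → EuclideanSpace ℝ (Fin 3)) ⁻¹' ball 0 r = ball 0 r := by
    ext x; simp [mem_ball, dist_zero_right]
  rw [hpre] at h
  exact h

/-- **ROUND-42 THEOREM B, STATIC FORM: anomalous crossings cost an exponential gradient.**  `V ∈ C¹(ℝ³, F)`, `‖e‖ = 1`,
`0 < γ`, `0 < R`, ball budgets `∫_{B(0,3R)} ‖V‖² ≤ X`, `∫_{B(0,3R)} ‖DV‖² ≤ Y`, `‖DV‖ ≤ G_m` on `B(0,3R)`; if every plane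
`⟪x, e⟫ = s`, `s ∈ [R, 2R]`, carries a point `y₁` with `‖y₁‖ ≤ 2R` and `γ s ≤ ‖V y₁‖`, and
`8(4X/R)/(π(γR)²) ≤ (3/4)(R/4)²`, then `(γR/(4(R/4)))·exp(π(γR)²/(32(4Y/R))) ≤ √2·G_m ∨ π(γR)²/(32(4Y/R)) ≤ log 2`.
[folklore (length–area method); cite: ConstantinIgnatovaVicol2026Putative, §3.4.1 for the setting] -/
theorem exp_le_gradient_or_small_of_crossings {F : Type*} [NormedAddCommGroup F] [NormedSpace ℝ F] [CompleteSpace F]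
    {V : EuclideanSpace ℝ (Fin 3) → F} (hV : ContDiff ℝ 1 V) {e : EuclideanSpace ℝ (Fin 3)} (he : ‖e‖ = 1)
    {γ R X Y Gm : ℝ} (hγ : 0 < γ) (hR : 0 < R) (hX : 0 < X) (hY : 0 < Y)
    (hA : ∫ x in ball (0 : EuclideanSpace ℝ (Fin 3)) (3 * R), ‖V x‖ ^ 2 ≤ X)
    (hE : ∫ x in ball (0 : EuclideanSpace ℝ (Fin 3)) (3 * R), ‖fderiv ℝ V x‖ ^ 2 ≤ Y)
    (hGm : ∀ z ∈ ball (0 : EuclideanSpace ℝ (Fin 3)) (3 * R), ‖fderiv ℝ V z‖ ≤ Gm)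
    (hcross : ∀ s ∈ Icc R (2 * R), ∃ y₁ : EuclideanSpace ℝ (Fin 3), ⟪y₁, e⟫ = s ∧ ‖y₁‖ ≤ 2 * R ∧ γ * s ≤ ‖V y₁‖)
    (hroom : 8 * (4 * X / R) / (Real.pi * (γ * R) ^ 2) ≤ 3 / 4 * (R / 4) ^ 2) :
    γ * R / (4 * (R / 4)) * Real.exp (Real.pi * (γ * R) ^ 2 / (32 * (4 * Y / R))) ≤ Real.sqrt 2 * Gm ∨
      Real.pi * (γ * R) ^ 2 / (32 * (4 * Y / R)) ≤ Real.log 2 := by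
  -- rotate `e` to `e₂`
  set e₂ : EuclideanSpace ℝ (Fin 3) := EuclideanSpace.basisFun (Fin 3) ℝ 2 with he₂
  have he₂1 : ‖e₂‖ = 1 := (EuclideanSpace.basisFun (Fin 3) ℝ).orthonormal.1 2
  obtain ⟨Rot, hRot⟩ := exists_linearIsometryEquiv_apply_eq he he₂1
  -- the rotated field (static transport only)
  set W : EuclideanSpace ℝ (Fin 3) → F := fun z => V (Rot.symm z) with hW
  have hWc : ContDiff ℝ 1 W := hV.comp Rot.symm.toContinuousLinearEquiv.contDiff
  have hDW : ∀ x, ‖fderiv ℝ W x‖ = ‖fderiv ℝ V (Rot.symm x)‖ := norm_fderiv_comp_linearIsometryEquiv V Rot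
  -- ball budgets and gradient bound for `W`
  have hA' : ∫ x in ball (0 : EuclideanSpace ℝ (Fin 3)) (3 * R), ‖W x‖ ^ 2 ≤ X := by
    have h := setIntegral_ball_comp_linearIsometryEquiv (fun x => ‖V x‖ ^ 2) Rot (3 * R)
    simp only [hW]
    rw [h]; exact hA
  have hE' : ∫ x in ball (0 : EuclideanSpace ℝ (Fin 3)) (3 * R), ‖fderiv ℝ W x‖ ^ 2 ≤ Y := by
    have h := setIntegral_ball_comp_linearIsometryEquiv (fun x => ‖fderiv ℝ V x‖ ^ 2) Rot (3 * R)
    simp_rw [hDW]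
    rw [h]; exact hE
  -- a quiet plane (t42-QP)
  obtain ⟨s, hs, hFs, hGs⟩ := exists_quietPlane (F := fun x => ‖W x‖ ^ 2) (G := fun x => ‖fderiv ℝ W x‖ ^ 2)
    (hWc.continuous.norm.pow 2) ((hWc.continuous_fderiv one_ne_zero).norm.pow 2)
    (fun x => sq_nonneg _) (fun x => sq_nonneg _) hR hX hY hA' hE'
  -- the anomalous point on it, rotated
  obtain ⟨y₁, hy₁e, hy₁R, hy₁V⟩ := hcross s hs
  set y₁' : EuclideanSpace ℝ (Fin 3) := Rot y₁ with hy₁'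
  have hy₁'2 : y₁' 2 = s := by
    rw [← EuclideanSpace.inner_basisFun_real (x := y₁') (i := 2), ← he₂, hy₁', ← hRot, Rot.inner_map_map, hy₁e]
  have hy₁'n : ‖y₁'‖ ≤ 2 * R := by rw [hy₁', Rot.norm_map]; exact hy₁R
  have hWy : γ * R ≤ ‖W y₁'‖ := by
    have h1 : γ * R ≤ γ * s := mul_le_mul_of_nonneg_left hs.1 hγ.le
    have h2 : W y₁' = V y₁ := by simp [hW, hy₁']
    rw [h2]; exact h1.trans hy₁V
  -- gradient bound on the disc around `y₁'`
  have hGm' : ∀ z ∈ closedBall y₁' (R / 4), ‖fderiv ℝ W z‖ ≤ Gm := by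
    intro z hz
    rw [hDW]
    apply hGm
    rw [mem_ball, dist_zero_right, Rot.symm.norm_map]
    rw [mem_closedBall, dist_eq_norm] at hz
    have : ‖z‖ ≤ ‖z - y₁'‖ + ‖y₁'‖ := norm_le_norm_sub_add z y₁'
    linarith
  have hfit : ‖y₁'‖ + 2 * (R / 4) < 3 * R := by linarith
  have hm : 0 < γ * R := mul_pos hγ hR
  have hrs : 0 < R / 4 := by positivity
  -- slice budgets at the height of `y₁'`
  rw [← hy₁'2] at hFs hGs
  exact exp_le_gradient_or_small_of_plane hWc hm hrs hfit hWy hGm' hFs hGs hroom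


open Literature.Analysis Literature.Analysis.FluidPDE in
/-- **ROUND-42 THEOREM B (nsreg-p2 g33), DYNAMIC FORM: leaving `B(0,2R)` backwards costs an exponential gradient.**
`V ∈ C¹(ℝ³, ℝ³)` with `‖DV‖ ≤ K` (a cut-off copy; the backward similarity flow `Ψ_σ = Φ^V_{−σ}` of `W = γx + V` exists),
`0 < γ`, ball budgets `∫_{B(0,3R)}‖V‖² ≤ X`, `∫_{B(0,3R)}‖DV‖² ≤ Y`, `‖DV‖ ≤ G_m` on `B(0,3R)`, room
`8(4X/R)/(π(γR)²) ≤ (3/4)(R/4)²`; if `‖y‖ < R` and `‖Ψ_L y‖ ≥ 2R` for some `L ≥ 0`, then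
`(γR/(4(R/4)))·exp(π(γR)²/(32(4Y/R))) ≤ √2·G_m ∨ π(γR)²/(32(4Y/R)) ≤ log 2`.
[first exit (t42a) + first hit of planes (t42a-PLANAR) + `exp_le_gradient_or_small_of_crossings`; folklore (length–area method);
cite: ConstantinIgnatovaVicol2026Putative, §3.4.1 for the setting] -/
theorem exp_le_gradient_or_small_of_exit {γ : ℝ} {V : EuclideanSpace ℝ (Fin 3) → EuclideanSpace ℝ (Fin 3)}
    (hV : ContDiff ℝ 1 V) {K : ℝ} (hK : ∀ y, ‖fderiv ℝ V y‖ ≤ K)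
    {R X Y Gm : ℝ} (hγ : 0 < γ) (hR : 0 < R) (hX : 0 < X) (hY : 0 < Y)
    (hA : ∫ x in ball (0 : EuclideanSpace ℝ (Fin 3)) (3 * R), ‖V x‖ ^ 2 ≤ X)
    (hE : ∫ x in ball (0 : EuclideanSpace ℝ (Fin 3)) (3 * R), ‖fderiv ℝ V x‖ ^ 2 ≤ Y)
    (hGm : ∀ z ∈ ball (0 : EuclideanSpace ℝ (Fin 3)) (3 * R), ‖fderiv ℝ V z‖ ≤ Gm)
    {y : EuclideanSpace ℝ (Fin 3)} (hy : ‖y‖ < R) {L : ℝ} (hL : 0 ≤ L)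
    (hexit : 2 * R ≤ ‖ODE.evolutionMap (fun _ : ℝ => selfSimilarTransport γ 0 V) 0 (-L) y‖)
    (hroom : 8 * (4 * X / R) / (Real.pi * (γ * R) ^ 2) ≤ 3 / 4 * (R / 4) ^ 2) :
    γ * R / (4 * (R / 4)) * Real.exp (Real.pi * (γ * R) ^ 2 / (32 * (4 * Y / R))) ≤ Real.sqrt 2 * Gm ∨
      Real.pi * (γ * R) ^ 2 / (32 * (4 * Y / R)) ≤ Real.log 2 := by
  -- first exit through the sphere of radius `2R`
  obtain ⟨σ₁, hσ₁, hlt, heq⟩ := exists_firstHit_of_exit (γ := γ) hV hK hL (hy.trans (by linarith)) hexit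
  set z : EuclideanSpace ℝ (Fin 3) := ODE.evolutionMap (fun _ : ℝ => selfSimilarTransport γ 0 V) 0 (-σ₁) y with hz
  have h2R : 0 < 2 * R := by positivity
  set e : EuclideanSpace ℝ (Fin 3) := (2 * R)⁻¹ • z with he
  have he1 : ‖e‖ = 1 := by
    rw [he, norm_smul, norm_inv, Real.norm_eq_abs, abs_of_pos h2R, heq, inv_mul_cancel₀ h2R.ne']
  -- every plane `⟪x, e⟫ = s`, `s ∈ [R, 2R]`, is crossed anomalously inside `B̄(0, 2R)`
  have hcross : ∀ s ∈ Icc R (2 * R), ∃ y₁ : EuclideanSpace ℝ (Fin 3), ⟪y₁, e⟫ = s ∧ ‖y₁‖ ≤ 2 * R ∧ γ * s ≤ ‖V y₁‖ := by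
    intro s hs
    have hys : ⟪y, e⟫ < s := by
      have h1 : ⟪y, e⟫ ≤ ‖y‖ * ‖e‖ := real_inner_le_norm y e
      rw [he1, mul_one] at h1
      linarith [hs.1]
    have hzs : s ≤ ⟪z, e⟫ := by
      have h1 : ⟪z, e⟫ = 2 * R := by
        rw [he, real_inner_smul_right, real_inner_self_eq_norm_sq, heq]
        field_simp
      rw [h1]; exact hs.2
    obtain ⟨σ₂, hσ₂, heq₂, -, hV₂⟩ := exists_anomalous_plane_of_exit (γ := γ) hV hK he1 hσ₁.1.le hys hzs
    refine ⟨_, heq₂, ?_, hV₂⟩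
    rcases hσ₂.2.lt_or_eq with hlt₂ | heq₂'
    · exact (hlt σ₂ ⟨hσ₂.1.le, hlt₂⟩).le
    · rw [heq₂']; exact heq.le
  exact exp_le_gradient_or_small_of_crossings hV he1 hγ hR hX hY hA hE hGm hcross hroom


open Literature.Analysis Literature.Analysis.FluidPDE in
/-- **(B′) NO EXIT UNDER A GRADIENT ENVELOPE** (nsreg-p2 g33's reading of THEOREM B, contrapositive): with the data of
`exp_le_gradient_or_small_of_exit`, if the exponent is large (`log 2 < π(γR)²/(32(4Y/R))`) and the gradient bound on
`B(0,3R)` is BELOW the condenser threshold (`√2·G_m < (γR/(4(R/4)))·exp(π(γR)²/(32(4Y/R)))`), then NO backward similarity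
orbit starting in `B(0,R)` reaches `‖·‖ ≥ 2R`: `‖Ψ_L y‖ < 2R` for all `L ≥ 0`. [folklore; cite: ConstantinIgnatovaVicol2026Putative, §3.4.1] -/
theorem norm_flow_lt_of_gradient_envelope {γ : ℝ} {V : EuclideanSpace ℝ (Fin 3) → EuclideanSpace ℝ (Fin 3)}
    (hV : ContDiff ℝ 1 V) {K : ℝ} (hK : ∀ y, ‖fderiv ℝ V y‖ ≤ K)
    {R X Y Gm : ℝ} (hγ : 0 < γ) (hR : 0 < R) (hX : 0 < X) (hY : 0 < Y)
    (hA : ∫ x in ball (0 : EuclideanSpace ℝ (Fin 3)) (3 * R), ‖V x‖ ^ 2 ≤ X)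
    (hE : ∫ x in ball (0 : EuclideanSpace ℝ (Fin 3)) (3 * R), ‖fderiv ℝ V x‖ ^ 2 ≤ Y)
    (hGm : ∀ z ∈ ball (0 : EuclideanSpace ℝ (Fin 3)) (3 * R), ‖fderiv ℝ V z‖ ≤ Gm)
    (hroom : 8 * (4 * X / R) / (Real.pi * (γ * R) ^ 2) ≤ 3 / 4 * (R / 4) ^ 2)
    (hbig : Real.log 2 < Real.pi * (γ * R) ^ 2 / (32 * (4 * Y / R)))
    (hsmall : Real.sqrt 2 * Gm < γ * R / (4 * (R / 4)) * Real.exp (Real.pi * (γ * R) ^ 2 / (32 * (4 * Y / R))))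
    {y : EuclideanSpace ℝ (Fin 3)} (hy : ‖y‖ < R) {L : ℝ} (hL : 0 ≤ L) :
    ‖ODE.evolutionMap (fun _ : ℝ => selfSimilarTransport γ 0 V) 0 (-L) y‖ < 2 * R := by
  by_contra h
  push Not at h
  rcases exp_le_gradient_or_small_of_exit hV hK hγ hR hX hY hA hE hGm hy hL h hroom with h1 | h2
  · linarith
  · linarith

end Summit.NavierStokesRegularity.NavierStokesRegularity.Theorems.PowerGaugeEulerLiouville.Condenser

end
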